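import Mathlib.Analysis.SpecialFunctions.Pow.Deriv
import Literature.Analysis.FluidPDE.SverakLandauBernoulliCalculus
import HarnessLib

/-!
# Šverák's classification of `(−1)`-homogeneous steady Navier–Stokes flows — calculus for the Obata identity

Analysis/FluidPDE support file of the series `SverakLandau*` proving the named fact
`Literature.Analysis.FluidPDE.Sverak2011_landauClassification` (V. Šverák, J. Math. Sci. 179
(2011) = arXiv:math/0604550, Thm. 1).

For a globally smooth, nowhere vanishing `Ψ : ℝ³ → ℝ` (in the application `e^{−Φ/2}` for the
regularised potential `Φ`) this file computes, in the coordinates `∂ₗ = pderiv l` of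
`CoordDerivatives`, the product-rule expressions consumed by the finite-sum lemmas of
`SverakLandauObataAlgebra`: with `g = ∇Ψ`, `H = ∇²Ψ`, `T = ∇³Ψ`, `L = ΔΨ`, `G = |g|²`,
`r² = |x|²`,

* `Sverak2011.pderiv_obataBr` — `∂ⱼ` of `brⱼ = r²(Hg)ⱼ + G xⱼ − ½r²L gⱼ` (`= Ψ Zⱼ`);
* `Sverak2011.pderiv_obataZ` — `∂ⱼ(Ψ⁻¹ brⱼ) = −Ψ⁻² gⱼ brⱼ + Ψ⁻¹ ∂ⱼbrⱼ`;
* `Sverak2011.sum_pderiv_obataB` — `∑ⱼ ∂ⱼB̃ⱼₘ` for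
  `B̃ₗₘ = r²Hₗₘ + gₗxₘ + xₗgₘ − ½r²L δₗₘ + ½L xₗxₘ`, collected in the shape of
  `Sverak2011.obata_divB_algebra`;
* `Sverak2011.pderiv_obataLam` — `∂ₘ(½r²L + Ψ) = gₘ + ½r²∂ₘL + L xₘ`;
* `Sverak2011.pderiv_obataBvec` — `∂ⱼ` of `bₘ = N gₘ + (Ψ − α)xₘW` for smooth `N`, `W` with
  `∂ⱼN = xⱼW`, `∂ⱼW = −xⱼW³` on an open set (`N = |x|`, `W = |x|⁻¹` there).

Pure bookkeeping (folklore); functions are passed as variables with defining equations.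

## References

* V. Šverák, *On Landau's solutions of the Navier–Stokes equations*, J. Math. Sci. 179 (2011)
  208–228, arXiv:math/0604550, §4. [`Sverak2011`]
-/

noncomputable section

open Set Filter
open scoped Topology BigOperators ContDiff

namespace Literature.Analysis.FluidPDE

namespace Sverak2011

variable {Ψ r2 Lf Gf N W : EuclideanSpace ℝ (Fin 3) → ℝ}
  {g Lj br : Fin 3 → EuclideanSpace ℝ (Fin 3) → ℝ}
  {H B : Fin 3 → Fin 3 → EuclideanSpace ℝ (Fin 3) → ℝ}
  {T : Fin 3 → Fin 3 → Fin 3 → EuclideanSpace ℝ (Fin 3) → ℝ}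

/-! ### Smoothness of the symbol functions -/

/-- All iterated coordinate partials of a smooth function are smooth. [folklore] -/
theorem contDiff_pderiv₂ (hΨ : ContDiff ℝ ∞ Ψ) (j m : Fin 3) :
    ContDiff ℝ ∞ (pderiv j (pderiv m Ψ)) :=
  contDiff_pderiv (contDiff_pderiv hΨ m) j

/-- Third coordinate partials of a smooth function are smooth. [folklore] -/
theorem contDiff_pderiv₃ (hΨ : ContDiff ℝ ∞ Ψ) (a b c : Fin 3) :
    ContDiff ℝ ∞ (pderiv a (pderiv b (pderiv c Ψ))) :=
  contDiff_pderiv (contDiff_pderiv₂ hΨ b c) a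

/-- `∂ⱼ L = ∑ₗ ∂ⱼ∂ₗ∂ₗΨ` for `L = ∑ₗ ∂ₗ∂ₗΨ`. [folklore] -/
theorem pderiv_obataL (hΨ : ContDiff ℝ ∞ Ψ)
    (hH : ∀ j m, H j m = pderiv j (pderiv m Ψ))
    (hT : ∀ a b c, T a b c = pderiv a (pderiv b (pderiv c Ψ)))
    (hL : Lf = fun x => ∑ l, H l l x) (j : Fin 3) :
    pderiv j Lf = fun x => ∑ l, T j l l x := by
  rw [hL, pderiv_sum (f := fun l x => H l l x) _ (fun l _ => by
    rw [show (fun x => H l l x) = H l l from rfl, hH]; exact (contDiff_pderiv₂ hΨ l l).differentiable (by simp))]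
  funext x
  refine Finset.sum_congr rfl fun l _ => ?_
  rw [show (fun x => H l l x) = H l l from rfl, hH, hT]

/-- `∂ⱼ G = 2 ∑ₗ gₗ ∂ⱼgₗ = 2∑ₗ gₗ Hⱼₗ` for `G = ∑ gₗ²`. [folklore] -/
theorem pderiv_obataG (hΨ : ContDiff ℝ ∞ Ψ) (hg : ∀ m, g m = pderiv m Ψ)
    (hH : ∀ j m, H j m = pderiv j (pderiv m Ψ))
    (hG : Gf = fun x => ∑ l, g l x ^ 2) (j : Fin 3) :
    pderiv j Gf = fun x => 2 * ∑ l, g l x * H j l x := by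
  have hgd : ∀ l, Differentiable ℝ (g l) := fun l => by
    rw [hg]; exact (contDiff_pderiv hΨ l).differentiable (by simp)
  rw [hG, pderiv_sum (f := fun l x => g l x ^ 2) _ (fun l _ => (hgd l).pow 2)]
  funext x
  rw [Finset.mul_sum]
  refine Finset.sum_congr rfl fun l _ => ?_
  have := congrFun (pderiv_pow (hgd l) 1 j) x
  simp only [pow_one, Nat.cast_one] at this
  rw [this, show pderiv j (g l) x = H j l x by rw [hg, hH]]
  ring

/-- **`∂ⱼ brⱼ`** for `brⱼ = r²∑ₘ Hⱼₘgₘ + G xⱼ − ½r²L gⱼ` (product rule; the shape consumed by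
`obata_div_algebra`). [folklore] -/
theorem pderiv_obataBr (hΨ : ContDiff ℝ ∞ Ψ) (hg : ∀ m, g m = pderiv m Ψ)
    (hH : ∀ j m, H j m = pderiv j (pderiv m Ψ))
    (hT : ∀ a b c, T a b c = pderiv a (pderiv b (pderiv c Ψ)))
    (hr2 : r2 = fun x => ∑ i, x i ^ 2) (hL : Lf = fun x => ∑ l, H l l x)
    (hG : Gf = fun x => ∑ l, g l x ^ 2) (hLj : ∀ j, Lj j = pderiv j Lf)
    (hbr : ∀ j, br j = fun x => r2 x * ∑ m, H j m x * g m x + Gf x * x j - r2 x * Lf x / 2 * g j x)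
    (j : Fin 3) :
    pderiv j (br j) = fun x => 2 * x j * ∑ m, H j m x * g m x +
      r2 x * ∑ m, (T j j m x * g m x + H j m x * H j m x) + (2 * ∑ l, g l x * H j l x) * x j + Gf x -
      ((x j * Lf x + r2 x * Lj j x / 2) * g j x + r2 x * Lf x / 2 * H j j x) := by
  have hgd : ∀ l, Differentiable ℝ (g l) := fun l => by
    rw [hg]; exact (contDiff_pderiv hΨ l).differentiable (by simp)
  have hHd : ∀ a b, Differentiable ℝ (H a b) := fun a b => by
    rw [hH]; exact (contDiff_pderiv₂ hΨ a b).differentiable (by simp)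
  have hr2d : Differentiable ℝ r2 := hr2 ▸ differentiable_normSq
  have hLd : Differentiable ℝ Lf := by
    rw [hL]; exact Differentiable.fun_sum fun l _ => hHd l l
  have hGd : Differentiable ℝ Gf := by
    rw [hG]; exact Differentiable.fun_sum fun l _ => (hgd l).pow 2
  have hS : Differentiable ℝ fun x => ∑ m, H j m x * g m x :=
    Differentiable.fun_sum fun m _ => (hHd j m).mul (hgd m)
  have h1 : Differentiable ℝ fun x => r2 x * ∑ m, H j m x * g m x := hr2d.mul hS
  have h2 : Differentiable ℝ fun x : EuclideanSpace ℝ (Fin 3) => Gf x * x j :=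
    hGd.mul (differentiable_coord j)
  have h3 : Differentiable ℝ fun x => r2 x * Lf x / 2 := by fun_prop
  have h4 : Differentiable ℝ fun x => r2 x * Lf x / 2 * g j x := h3.mul (hgd j)
  rw [hbr, pderiv_sub (f := fun x => r2 x * ∑ m, H j m x * g m x + Gf x * x j)
      (g := fun x => r2 x * Lf x / 2 * g j x) (h1.add h2) h4,
    pderiv_add (f := fun x => r2 x * ∑ m, H j m x * g m x) (g := fun x => Gf x * x j) h1 h2,
    pderiv_mul (f := r2) (g := fun x => ∑ m, H j m x * g m x) hr2d hS,
    pderiv_sum (f := fun m x => H j m x * g m x) _ (fun m _ => (hHd j m).mul (hgd m)),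
    pderiv_mul (f := Gf) (g := fun x => x j) hGd (differentiable_coord j),
    pderiv_mul (f := fun x => r2 x * Lf x / 2) (g := g j) h3 (hgd j)]
  funext x
  beta_reduce
  have e1 : pderiv j r2 x = 2 * x j := by rw [hr2, pderiv_normSq]
  have e2 : ∀ m, pderiv j (fun x => H j m x * g m x) x = T j j m x * g m x + H j m x * H j m x := by
    intro m
    rw [pderiv_mul (hHd j m) (hgd m)]
    beta_reduce
    rw [show pderiv j (H j m) x = T j j m x by rw [hH, hT],
      show pderiv j (g m) x = H j m x by rw [hg, hH]]
  have e3 : pderiv j Gf x = 2 * ∑ l, g l x * H j l x := by rw [pderiv_obataG hΨ hg hH hG j]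
  have e4 : pderiv j (fun x => r2 x * Lf x / 2) x = (2 * x j * Lf x + r2 x * Lj j x) / 2 := by
    have : (fun x => r2 x * Lf x / 2) = fun x => 2⁻¹ * (r2 x * Lf x) := by funext x; ring
    rw [this, pderiv_const_mul (f := fun x => r2 x * Lf x) (hr2d.mul hLd),
      pderiv_mul hr2d hLd]
    beta_reduce
    rw [e1, hLj]
    ring
  have e5 : pderiv j (g j) x = H j j x := by rw [hg, hH]
  rw [e1, Finset.sum_congr rfl fun m _ => e2 m, e3, pderiv_coord, e4, e5]
  simp only [if_true]
  ring

/-- `x ↦ (Ψ x)⁻¹` is differentiable with `∂ⱼ Ψ⁻¹ = −Ψ⁻² gⱼ` when `Ψ` never vanishes. [folklore] -/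
theorem pderiv_inv_of_ne_zero (hΨ : ContDiff ℝ ∞ Ψ) (hΨ0 : ∀ x, Ψ x ≠ 0)
    (hg : ∀ m, g m = pderiv m Ψ) (j : Fin 3) :
    Differentiable ℝ (fun x => (Ψ x)⁻¹) ∧
      pderiv j (fun x => (Ψ x)⁻¹) = fun x => -((Ψ x) ^ 2)⁻¹ * g j x := by
  have hΨd : Differentiable ℝ Ψ := hΨ.differentiable (by simp)
  refine ⟨fun x => (hΨd x).inv (hΨ0 x), funext fun x => ?_⟩
  have h := (hasDerivAt_inv (hΨ0 x)).comp_hasFDerivAt x (hΨd x).hasFDerivAt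
  rw [pderiv_apply, show (fun y => (Ψ y)⁻¹) = Inv.inv ∘ Ψ from rfl, h.fderiv]
  simp only [FunLike.coe_smul, Pi.smul_apply, smul_eq_mul, hg, pderiv_apply]

/-- **`∂ⱼ(Ψ⁻¹ brⱼ) = −Ψ⁻² gⱼ brⱼ + Ψ⁻¹ ∂ⱼbrⱼ`** (`Zⱼ = Ψ⁻¹ brⱼ`). [folklore] -/
theorem pderiv_obataZ (hΨ : ContDiff ℝ ∞ Ψ) (hΨ0 : ∀ x, Ψ x ≠ 0) (hg : ∀ m, g m = pderiv m Ψ)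
    (j : Fin 3) (hbrd : Differentiable ℝ (br j)) (x : EuclideanSpace ℝ (Fin 3)) :
    pderiv j (fun x => (Ψ x)⁻¹ * br j x) x =
      -((Ψ x) ^ 2)⁻¹ * g j x * br j x + (Ψ x)⁻¹ * pderiv j (br j) x := by
  obtain ⟨hd, hp⟩ := pderiv_inv_of_ne_zero hΨ hΨ0 hg j
  rw [pderiv_mul hd hbrd]
  beta_reduce
  rw [hp]

/-! ### The tensor `B̃` and the scalar `λ` -/

/-- **Row divergence of `B̃`** in the collected shape of `obata_divB_algebra`:
`∑ⱼ ∂ⱼB̃ⱼₘ = ∑ⱼ(2xⱼHⱼₘ + r²Tⱼⱼₘ) + (L xₘ + gₘ) + (3gₘ + ∑ⱼ xⱼHⱼₘ) − (xₘL + ½r²Lₘ) +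
(½(∑ⱼ Lⱼxⱼ)xₘ + 2L xₘ)`. [folklore] -/
theorem sum_pderiv_obataB (hΨ : ContDiff ℝ ∞ Ψ) (hg : ∀ m, g m = pderiv m Ψ)
    (hH : ∀ j m, H j m = pderiv j (pderiv m Ψ))
    (hT : ∀ a b c, T a b c = pderiv a (pderiv b (pderiv c Ψ)))
    (hr2 : r2 = fun x => ∑ i, x i ^ 2) (hL : Lf = fun x => ∑ l, H l l x)
    (hLj : ∀ j, Lj j = pderiv j Lf)
    (hB : ∀ l m, B l m = fun x => r2 x * H l m x + g l x * x m + x l * g m x -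
      r2 x * Lf x / 2 * (if l = m then 1 else 0) + Lf x / 2 * (x l * x m))
    (m : Fin 3) (x : EuclideanSpace ℝ (Fin 3)) :
    ∑ j, pderiv j (B j m) x = ∑ j, (2 * x j * H j m x + r2 x * T j j m x) +
      (Lf x * x m + g m x) + (3 * g m x + ∑ j, x j * H j m x) - (x m * Lf x + r2 x * Lj m x / 2) +
      ((∑ j, Lj j x * x j) * x m / 2 + 2 * Lf x * x m) := by
  have hgd : ∀ l, Differentiable ℝ (g l) := fun l => by
    rw [hg]; exact (contDiff_pderiv hΨ l).differentiable (by simp)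
  have hHd : ∀ a b, Differentiable ℝ (H a b) := fun a b => by
    rw [hH]; exact (contDiff_pderiv₂ hΨ a b).differentiable (by simp)
  have hr2d : Differentiable ℝ r2 := hr2 ▸ differentiable_normSq
  have hLd : Differentiable ℝ Lf := by
    rw [hL]; exact Differentiable.fun_sum fun l _ => hHd l l
  have h3 : Differentiable ℝ fun x => r2 x * Lf x / 2 := by fun_prop
  have hL2 : Differentiable ℝ fun x => Lf x / 2 := by fun_prop
  have e1 : ∀ j, pderiv j r2 x = 2 * x j := fun j => by rw [hr2, pderiv_normSq]
  have e4 : ∀ j, pderiv j (fun x => r2 x * Lf x / 2) x = x j * Lf x + r2 x * Lj j x / 2 := by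
    intro j
    have : (fun x => r2 x * Lf x / 2) = fun x => 2⁻¹ * (r2 x * Lf x) := by funext x; ring
    rw [this, pderiv_const_mul (f := fun x => r2 x * Lf x) (hr2d.mul hLd), pderiv_mul hr2d hLd]
    beta_reduce
    rw [e1, hLj]; ring
  have e6 : ∀ j, pderiv j (fun x => Lf x / 2) x = Lj j x / 2 := by
    intro j
    have : (fun x => Lf x / 2) = fun x => 2⁻¹ * Lf x := by funext x; ring
    rw [this, pderiv_const_mul (f := Lf) hLd]
    beta_reduce
    rw [hLj]; ring
  -- termwise derivative of `B j m`
  have key : ∀ j, pderiv j (B j m) x = (2 * x j * H j m x + r2 x * T j j m x) +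
      (H j j x * x m + g j x * if m = j then 1 else 0) + (g m x + x j * H j m x) -
      ((x j * Lf x + r2 x * Lj j x / 2) * if j = m then 1 else 0) +
      (Lj j x / 2 * (x j * x m) + Lf x / 2 * (x m + x j * if m = j then 1 else 0)) := by
    intro j
    have d1 : Differentiable ℝ fun x => r2 x * H j m x := hr2d.mul (hHd j m)
    have d2 : Differentiable ℝ fun x : EuclideanSpace ℝ (Fin 3) => g j x * x m :=
      (hgd j).mul (differentiable_coord m)
    have d3 : Differentiable ℝ fun x : EuclideanSpace ℝ (Fin 3) => x j * g m x :=
      (differentiable_coord j).mul (hgd m)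
    have d4 : Differentiable ℝ fun x => r2 x * Lf x / 2 * (if j = m then (1 : ℝ) else 0) :=
      h3.mul (differentiable_const _)
    have d5 : Differentiable ℝ fun x : EuclideanSpace ℝ (Fin 3) => Lf x / 2 * (x j * x m) :=
      hL2.mul ((differentiable_coord j).mul (differentiable_coord m))
    rw [hB, pderiv_add (f := fun x => r2 x * H j m x + g j x * x m + x j * g m x -
          r2 x * Lf x / 2 * (if j = m then (1 : ℝ) else 0))
        (g := fun x => Lf x / 2 * (x j * x m)) (((d1.add d2).add d3).sub d4) d5,
      pderiv_sub (f := fun x => r2 x * H j m x + g j x * x m + x j * g m x)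
        (g := fun x => r2 x * Lf x / 2 * (if j = m then (1 : ℝ) else 0)) ((d1.add d2).add d3) d4,
      pderiv_add (f := fun x => r2 x * H j m x + g j x * x m) (g := fun x => x j * g m x)
        (d1.add d2) d3,
      pderiv_add (f := fun x => r2 x * H j m x) (g := fun x => g j x * x m) d1 d2,
      pderiv_mul (f := r2) (g := H j m) hr2d (hHd j m),
      pderiv_mul (f := g j) (g := fun x => x m) (hgd j) (differentiable_coord m),
      pderiv_mul (f := fun x => x j) (g := g m) (differentiable_coord j) (hgd m),
      pderiv_mul (f := fun x => r2 x * Lf x / 2) (g := fun _ => if j = m then (1 : ℝ) else 0) h3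
        (differentiable_const _),
      pderiv_mul (f := fun x => Lf x / 2) (g := fun x => x j * x m) hL2
        ((differentiable_coord j).mul (differentiable_coord m)),
      pderiv_mul (f := fun x => x j) (g := fun x => x m) (differentiable_coord j)
        (differentiable_coord m), pderiv_const]
    beta_reduce
    simp only [pderiv_coord]
    rw [e1, e4, e6,
      show pderiv j (H j m) x = T j j m x by rw [hH, hT],
      show pderiv j (g j) x = H j j x by rw [hg, hH],
      show pderiv j (g m) x = H j m x by rw [hg, hH]]
    simp only [if_true, mul_zero, add_zero]
    ring
  simp only [key, Finset.sum_add_distrib, Finset.sum_sub_distrib]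
  simp only [hL, Fin.sum_univ_three, Fin.isValue]
  fin_cases m <;> simp <;> ring

/-- **`∂ₘ λ`** for `λ = ½r²L + Ψ`: `∂ₘλ = gₘ + ½r²Lₘ + L xₘ`. [folklore] -/
theorem pderiv_obataLam (hΨ : ContDiff ℝ ∞ Ψ) (hg : ∀ m, g m = pderiv m Ψ)
    (hH : ∀ j m, H j m = pderiv j (pderiv m Ψ))
    (hr2 : r2 = fun x => ∑ i, x i ^ 2) (hL : Lf = fun x => ∑ l, H l l x)
    (hLj : ∀ j, Lj j = pderiv j Lf) (m : Fin 3) (x : EuclideanSpace ℝ (Fin 3)) :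
    pderiv m (fun x => r2 x * Lf x / 2 + Ψ x) x = g m x + r2 x / 2 * Lj m x + Lf x * x m := by
  have hHd : ∀ a b, Differentiable ℝ (H a b) := fun a b => by
    rw [hH]; exact (contDiff_pderiv₂ hΨ a b).differentiable (by simp)
  have hr2d : Differentiable ℝ r2 := hr2 ▸ differentiable_normSq
  have hLd : Differentiable ℝ Lf := by
    rw [hL]; exact Differentiable.fun_sum fun l _ => hHd l l
  have h3 : Differentiable ℝ fun x => r2 x * Lf x / 2 := by fun_prop
  rw [pderiv_add h3 (hΨ.differentiable (by simp))]
  beta_reduce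
  have : (fun x => r2 x * Lf x / 2) = fun x => 2⁻¹ * (r2 x * Lf x) := by funext x; ring
  rw [this, pderiv_const_mul (f := fun x => r2 x * Lf x) (hr2d.mul hLd), pderiv_mul hr2d hLd]
  beta_reduce
  rw [show pderiv m r2 x = 2 * x m by rw [hr2, pderiv_normSq], ← hLj, ← hg]
  ring

/-- **`∂ⱼ bₘ`** for `bₘ = N gₘ + (Ψ − α)xₘW` with smooth `N`, `W` satisfying `∂ⱼN = xⱼW`,
`∂ⱼW = −xⱼW³` on the open set `S` (`N = |x|`, `W = |x|⁻¹` there): on `S`,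
`∂ⱼbₘ = xⱼW gₘ + N Hⱼₘ + (gⱼxₘW + (Ψ − α)(δⱼₘW + xₘ(−xⱼW³)))`. [folklore] -/
theorem pderiv_obataBvec (hΨ : ContDiff ℝ ∞ Ψ) (hN : ContDiff ℝ ∞ N) (hW : ContDiff ℝ ∞ W)
    (hg : ∀ m, g m = pderiv m Ψ) (hH : ∀ j m, H j m = pderiv j (pderiv m Ψ))
    {S : Set (EuclideanSpace ℝ (Fin 3))}
    (hdN : ∀ y ∈ S, ∀ j, pderiv j N y = y j * W y) (hdW : ∀ y ∈ S, ∀ j, pderiv j W y = -y j * W y ^ 3)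
    (α : ℝ) (j m : Fin 3) {y : EuclideanSpace ℝ (Fin 3)} (hy : y ∈ S) :
    pderiv j (fun x => N x * g m x + (Ψ x - α) * x m * W x) y =
      y j * W y * g m y + N y * H j m y +
        (g j y * y m * W y + (Ψ y - α) * ((if j = m then 1 else 0) * W y + y m * (-y j * W y ^ 3))) := by
  have hgd : ∀ l, Differentiable ℝ (g l) := fun l => by
    rw [hg]; exact (contDiff_pderiv hΨ l).differentiable (by simp)
  have hNd : Differentiable ℝ N := hN.differentiable (by simp)
  have hWd : Differentiable ℝ W := hW.differentiable (by simp)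
  have hΨd : Differentiable ℝ Ψ := hΨ.differentiable (by simp)
  have d1 : Differentiable ℝ fun x => N x * g m x := hNd.mul (hgd m)
  have d2 : Differentiable ℝ fun x : EuclideanSpace ℝ (Fin 3) => (Ψ x - α) * x m :=
    (hΨd.sub_const α).mul (differentiable_coord m)
  have d3 : Differentiable ℝ fun x : EuclideanSpace ℝ (Fin 3) => (Ψ x - α) * x m * W x := d2.mul hWd
  rw [pderiv_add d1 d3, pderiv_mul hNd (hgd m), pderiv_mul d2 hWd,
    pderiv_mul (f := fun x => Ψ x - α) (g := fun x => x m) (hΨd.sub_const α) (differentiable_coord m),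
    pderiv_sub (f := Ψ) (g := fun _ => α) hΨd (differentiable_const _), pderiv_const]
  beta_reduce
  rw [hdN y hy j, hdW y hy j, pderiv_coord, show pderiv j (g m) y = H j m y by rw [hg, hH], ← hg]
  by_cases hjm : j = m
  · subst hjm; simp only [if_true]; ring
  · simp only [hjm, Ne.symm hjm, if_false]; ring

end Sverak2011

end Literature.Analysis.FluidPDE
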